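import Mathlib
import Summits.ResolutionOfSingularities.ResolutionOfSingularities.Theorems.WeightedInvariantLocalWeightedDropNCDirectrixCutPhase

/-!
# `WeightedInvariant.LocalWeightedDrop`, line `directrix-cut`: IN FOUR LETTERS A NON-UNARY VERTEX HAS APEX DIMENSION ≤ 2
# (the `htwo` binder of the surface regime `ApexPlaneSurfaceExit k 3` from `¬ UnaryVertex`)

Crux item stmt-ResolutionOfSingularities-8899 `LocalWeightedDrop` (route `ResolutionOfSingularities/WeightedInvariant`), ENGINE skeleton v32/v33, residual
`stub_wildWideApexFourStartsWon` (res-L1-w43-strat-1's line `directrix-cut` v3.1, piece PL = `ApexPlaneExit k 3`; S-E2-SURF memo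
`L/res-L1-w43-stub-4/g5/S-E2-SURF.md`).  [OURS · L1 W4.3 · chain w43 · seat res-L1-w43-stub-4 gen 5; def-free on …NCDirectrixCutPhase (`UnaryVertex`);
linear algebra only; nothing here is a statement of any manuscript; AI-produced, gate-checked, weaker than expert review.]

* **`apexPlane_of_not_unaryVertex`** — at `m = 3` (four letters): if the vertex is not unary (no three linearly independent invariance vectors of
  the degree-`c` form of `f·∏_O x_l`), then every three invariance vectors are dependent — the apex-dimension-`≤ 2` hypothesis (`htwo`) of the
  S-E2-SURF files and of `ApexPlaneSurfaceExit k 3`.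
-/

set_option linter.dupNamespace false -- mandated namespace of this single-conjunct summit

noncomputable section

namespace Summit.ResolutionOfSingularities.ResolutionOfSingularities.Theorems

namespace TameFourTupleDrop

open MvPowerSeries Literature.AlgebraicGeometry.Resolution

variable {k : Type} [Field k]

/-- **IN FOUR LETTERS, A NON-UNARY VERTEX HAS APEX DIMENSION ≤ 2**: `¬ UnaryVertex δ` ⇒ every three invariance vectors of `in_c(f·∏_O x_l)` are
linearly dependent. -/
theorem apexPlane_of_not_unaryVertex {δ : Decoration k 3} (hnU : ¬ UnaryVertex δ) :
    ∀ u₁ u₂ u₃ : Fin 4 → k,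
      (∀ v, CobordantChart.initEval (fun _ : Fin 4 => 1) (v + u₁) δ.c (δ.f * ∏ l ∈ δ.O, X l) =
        CobordantChart.initEval (fun _ : Fin 4 => 1) v δ.c (δ.f * ∏ l ∈ δ.O, X l)) →
      (∀ v, CobordantChart.initEval (fun _ : Fin 4 => 1) (v + u₂) δ.c (δ.f * ∏ l ∈ δ.O, X l) =
        CobordantChart.initEval (fun _ : Fin 4 => 1) v δ.c (δ.f * ∏ l ∈ δ.O, X l)) →
      (∀ v, CobordantChart.initEval (fun _ : Fin 4 => 1) (v + u₃) δ.c (δ.f * ∏ l ∈ δ.O, X l) =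
        CobordantChart.initEval (fun _ : Fin 4 => 1) v δ.c (δ.f * ∏ l ∈ δ.O, X l)) →
      ∃ α β γ : k, (α ≠ 0 ∨ β ≠ 0 ∨ γ ≠ 0) ∧ α • u₁ + β • u₂ + γ • u₃ = 0 := by
  intro u₁ u₂ u₃ h₁ h₂ h₃
  by_contra hind
  push Not at hind
  apply hnU
  refine ⟨![u₁, u₂, u₃], ?_, ?_⟩
  · rw [Fintype.linearIndependent_iff]
    intro g hg j
    have hsum : g 0 • u₁ + g 1 • u₂ + g 2 • u₃ = 0 := by
      rw [Fin.sum_univ_three] at hg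
      simpa using hg
    have h := hind (g 0) (g 1) (g 2)
    by_contra hj
    have hne : g 0 ≠ 0 ∨ g 1 ≠ 0 ∨ g 2 ≠ 0 := by
      fin_cases j
      · exact Or.inl hj
      · exact Or.inr (Or.inl hj)
      · exact Or.inr (Or.inr hj)
    exact h hne hsum
  · intro j v
    fin_cases j
    · exact h₁ v
    · exact h₂ v
    · exact h₃ v

end TameFourTupleDrop

end Summit.ResolutionOfSingularities.ResolutionOfSingularities.Theorems

end
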